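import Mathlib.MeasureTheory.Measure.Lebesgue.Basic
import Mathlib.Analysis.SpecialFunctions.Complex.Circle
import Summits.ABC.IUTFork.ForkBPS
import Summits.ABC.IUTFork.ForkInflation
import Summits.ABC.IUTFork.LanaMeasureContainer
import Summits.ABC.IUTFork.Cor312Remarks
import Summits.ABC.IUTFork.LanaCyclotomes
import Summits.ABC.IUTFork.Cor312GapGlobalCountermodel
import HarnessLib

/-!
# [IUTchIII] Cor. 3.12 cone — NON-VACUITY of six interface structures of the fork skeleton
# (`UnitPortion`, `ValueGroupBPS`/`BPS`, `IndData`, `Cor312Rmk.GeneralizedVolumes`, `LocalCyclotomicRigidity`,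
# `InputStrip.LocalVolumes`)

PROOF-ONLY support file of the abc-iut cell (wave-5 prover seat abc-iut-w5-d114, gen 3; ADJUDICATION-SPEC §4 (iii)
«instantiated / not yet witnessed» register, C312 column of abc-iut-w5-d056's KERNEL INHABITATION CENSUS v3
2026-08-26T04:20Z: each structure below had NO producer in the tree). House style of the cell's non-vacuity wave:
NO `def`, NO `instance`, NO `structure`, NO notation — every witness is built inside a theorem term, and each
theorem is labelled DEGENERATE / MODEL / EXACT CONDITION honestly. TAKES NO SIDE on [IUTchIII] Cor. 3.12; a witness
certifies JOINT SATISFIABILITY of the typed fields (so that the cell's theorems quantifying over these structures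
are about something), nothing about the genuine inter-universal objects.

What is recorded (structure ↦ theorems):

* `ValueGroupBPS V bad` (LANA Def. 4.1.3, `ForkBPS` XIII) ↦ `ValueGroupBPS.nonempty_iff` — EXACT CONDITION:
  inhabited iff `V^bad ≠ ∅` (necessity is the file's own `bad_nonempty`; sufficiency: `C := ℝ`, all local pilots `1`).
* `UnitPortion` (LANA Def. 4.1.2 interface) ↦ `UnitPortion.nonempty` (DEGENERATE: one object, one isomorphism) and
  `UnitPortion.exists_iso_not_subsingleton` (ONE-OBJECT GROUPOID MODEL `B(Sym {0,1})`: the isomorphism type is NOT a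
  singleton — the shape LANA §6 p. 31 needs for (Ind1)/(Ind2) to be non-trivial).
* `BPS 𝓤 V bad` (LANA Def. 4.1.6) ↦ `BPS.nonempty_iff` — EXACT CONDITION `Nonempty 𝓤.Obj ∧ V^bad ≠ ∅` — and
  `BPS.exists_iso_not_subsingleton`: BPSs with equal product formula whose isomorphism type is not a singleton exist
  (teeth for XIII's `BPS.isoEquivUnit` «all the freedom of a link sits in the unit portion»).
* `IndData V` (Dupuy–Hilado §4.11 indeterminacy data, `ForkInflation` XVIII) ↦ necessity `IndData.adm_bare3` /
  `IndData.exists_adm_hull_superset`; sufficiency `IndData.exists_stabilizer_model` — the SET-STABILISER MODEL over ANY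
  volume container: (Ind1) = (Ind2) := the full stabiliser of the (Ind3)-region in `Sym(𝕃)`, for which XVIII's
  modelling hypothesis of `representedVol_iff_of_preserving` («(Ind1), (Ind2) preserve `ln ν̄`») HOLDS and Reading 1
  reads `ln ν̄((O_𝕃(−P_Θ))^{Ind3}) = ln ν̄(Q)`; and `IndData.exists_lebesgue_model` — the same at abc-iut-c312-4's
  `measureContainer` of LEBESGUE MEASURE ON `ℝ` (bare `[0,1]` ⊂ bare3 `[0,2]`, `Q = [0,1]`): `−|log(Θ)| = log 2`,
  `−|log(q)| = 0`, the setting's `Cor312` inequality HOLDS while Reading 1 `RepresentedVol` FAILS (the two readings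
  separate on a real measure).
* `Cor312Rmk.GeneralizedVolumes` ([IUTchIII] Rmk 3.12.1 (ii) numbers) ↦ `GeneralizedVolumes.exists_cor312` /
  `exists_not_cor312` (at `λ = 1`) and `exists_cor312_half` / `exists_not_cor312_half` (at `λ = 1/2`): the record is
  inhabited both with the claim-form `Cor312` TRUE and FALSE — the claim-form is not forced by the typed fields.
* `LocalCyclotomicRigidity G M ΛG` (LANA §6.3 (6-5) interface, `LanaCyclotomes` X) ↦ `nonempty_self` — TAUTOLOGICAL
  witness at `Λ(G) := Λ(M)`, `ι := id`, for EVERY `G ↷ M`; `exists_ne_of_ne_inv` — if `Λ(M)` has an element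
  `ζ ≠ ζ⁻¹` there are TWO DISTINCT rigidity data onto the same `Λ(G)` (`id` and inversion, both `G`-equivariant): the
  typed form of §6.3's «only the `Ẑ^×`-orbit is determined» — the interface does not pin `ι`; and
  `exists_ne_complexUnits` — this happens for `M := ℂˣ` (the compatible system `n ↦ exp(2πi/n)` is an element of
  `Λ(ℂˣ)` with `ζ ≠ ζ⁻¹`), unconditionally.
* `InputStrip.LocalVolumes A` (per-packet volume datum, `Cor312GapGlobalCountermodel` XXVI) ↦ `LocalVolumes.nonempty` for
  EVERY strip algorithm (all inputs read at the `q`-pilot's local volumes) and `exists_gapGlobal_not_soundPerPacket`: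
  XXVI's `lg_gapGlobal_not_soundPerPacket` instantiated — there IS a strip algorithm with a per-packet volume datum over
  `LocalGlobal.lgSetting` at which the global gap holds and per-packet soundness fails.

NOT here: `EtaTemperedSide` / `EtaEvalSide` (LANA §-sides over the tempered-curve / theta-setting interfaces; left to
the L-LANA lineage abc-iut-c312-4). Classical content only. [claim: Mochizuki2012, status: disputed] for the quoted
interfaces; typed ≠ proved; instantiated ≠ endorsed; «not yet witnessed» never meant «vacuous».
-/

noncomputable section

open Set

namespace Summit.ABC
namespace IUTFork

/-! ## 1. LANA's basic prime strips (`ForkBPS`, XIII) -/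

namespace ValueGroupBPS

variable {V : Type} [Fintype V] {bad : Finset V}

/-- **EXACT INHABITATION CONDITION for LANA Def. 4.1.3**: a value-group BPS over `(V, V^bad)` exists iff
`V^bad ≠ ∅` — necessity is `bad_nonempty` (the pilot is a nonzero sum over `V^bad`), sufficiency is the line `C := ℝ`
with every local pilot `φ_v := 1` (pilot `= #V^bad ≠ 0`). [cite: LANA2026Report, Def. 4.1.3 pp. 23–24] -/
theorem nonempty_iff : Nonempty (ValueGroupBPS V bad) ↔ bad.Nonempty := by
  constructor
  · rintro ⟨B⟩
    exact B.bad_nonempty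
  · intro h
    refine ⟨
      { C := ℝ, rank_one := Module.finrank_self ℝ, φ := fun _ => 1, φ_ne := fun _ => one_ne_zero
        pilot_ne := ?_ }⟩
    rw [Finset.sum_const, nsmul_eq_mul, mul_one]
    exact Nat.cast_ne_zero.mpr h.card_pos.ne'

end ValueGroupBPS

namespace UnitPortion

/-- DEGENERATE witness of the étale-unit-portion interface (LANA Def. 4.1.2): ONE object with ONE isomorphism.
Certifies only that the three typed fields are jointly satisfiable. [cite: LANA2026Report, Def. 4.1.2 p. 23] -/
theorem nonempty : Nonempty UnitPortion :=
  ⟨{ Obj := PUnit, Iso := fun _ _ => PUnit, conn := fun _ _ => ⟨PUnit.unit⟩ }⟩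

/-- ONE-OBJECT GROUPOID MODEL `B(Sym {0,1})` of the étale-unit-portion interface: one object («abstractly isomorphic to»
the standard one) whose isomorphisms are the permutations of a two-element set — connected, and the isomorphism type
is NOT a singleton. This is the shape in which (Ind1)/(Ind2) («the indeterminacy arising from `Aut(G_v)`», «the
automorphism group of `O^×_v`», LANA §6 p. 31) are non-trivial; nothing here models `G_v ↷ O^{×μ}_v` itself.
[cite: LANA2026Report, Def. 4.1.2 p. 23, §6 p. 31] -/
theorem exists_iso_not_subsingleton :
    ∃ 𝓤 : UnitPortion, Nonempty 𝓤.Obj ∧ ∀ a b : 𝓤.Obj, ¬ Subsingleton (𝓤.Iso a b) := by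
  refine ⟨{ Obj := PUnit, Iso := fun _ _ => Equiv.Perm Bool, conn := fun _ _ => ⟨Equiv.refl Bool⟩ },
    ⟨PUnit.unit⟩, ?_⟩
  intro _ _ h
  have h1 := Equiv.congr_fun (h.elim (Equiv.refl Bool) (Equiv.swap true false)) true
  simp at h1

end UnitPortion

namespace BPS

variable {𝓤 : UnitPortion} {V : Type} [Fintype V] {bad : Finset V}

/-- **EXACT INHABITATION CONDITION for LANA Def. 4.1.6 (1)**: a BPS with étale-unit portion drawn from `𝓤` exists iff
`𝓤` has an object and `V^bad ≠ ∅`. [cite: LANA2026Report, Def. 4.1.6 p. 24] -/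
theorem nonempty_iff : Nonempty (BPS 𝓤 V bad) ↔ Nonempty 𝓤.Obj ∧ bad.Nonempty := by
  constructor
  · rintro ⟨B⟩
    exact ⟨⟨B.unit⟩, B.val.bad_nonempty⟩
  · rintro ⟨⟨u⟩, h⟩
    obtain ⟨val⟩ := ValueGroupBPS.nonempty_iff.mpr h
    exact ⟨⟨u, val⟩⟩

/-- TEETH for XIII's `BPS.isoEquivUnit` («granted `PF(B) = PF(B′)`, isomorphisms of BPSs ↔ isomorphisms of the étale-unit
portions»): over any `V^bad ≠ ∅` there are a unit-portion interface and BPSs `B, B′` with `PF(B) = PF(B′)` whose type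
of isomorphisms `B ⥲ B′` is NOT a singleton (take `B = B′` over the one-object groupoid `B(Sym {0,1})`) — so «the»
link is a genuine datum in the typed object, carried entirely by the unit portion. [cite: LANA2026Report, §6 p. 31] -/
theorem exists_iso_not_subsingleton (h : bad.Nonempty) :
    ∃ (𝓤 : UnitPortion) (B B' : BPS 𝓤 V bad), B.val.PF = B'.val.PF ∧ ¬ Subsingleton (B.Iso B') := by
  obtain ⟨𝓤, ⟨u⟩, h𝓤⟩ := UnitPortion.exists_iso_not_subsingleton
  obtain ⟨val⟩ := ValueGroupBPS.nonempty_iff.mpr h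
  refine ⟨𝓤, ⟨u, val⟩, ⟨u, val⟩, rfl, fun hs => h𝓤 u u ?_⟩
  exact @Equiv.subsingleton _ _ (BPS.isoEquivUnit ⟨u, val⟩ ⟨u, val⟩ rfl).symm hs

end BPS

/-! ## 2. Dupuy–Hilado indeterminacy data (`ForkInflation`, XVIII) -/

namespace IndData

open Pointwise

variable {V : VolumeContainer}

/-- NECESSITY 1: the (Ind3)-enlarged region of any indeterminacy datum is admissible (it is the possible image of the
identity indeterminacies `(1, 1)`). [cite: DupuyHilado2025, §4.11 p. 16] -/
theorem adm_bare3 (I : IndData V) : V.Adm I.bare3 := by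
  simpa only [one_smul] using I.image_adm 1 1

/-- NECESSITY 2: some superset of the (Ind3)-region (the union `U_Θ` of the possible images) has an admissible hull.
[cite: DupuyHilado2025, §1 p. 4] -/
theorem exists_adm_hull_superset (I : IndData V) : ∃ U : Set V.L, I.bare3 ⊆ U ∧ V.Adm (V.hull U) :=
  ⟨⋃ p : I.G₂ × I.G₁, p.1 • p.2 • I.bare3,
    fun x hx => Set.mem_iUnion.mpr ⟨(1, 1), by simpa only [one_smul] using hx⟩, I.hull_adm⟩

/-- **SUFFICIENCY — the SET-STABILISER MODEL over ANY volume container.** Given regions `A ⊆ B` and `Q` with `B`,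
`hull(B)` and `Q` admissible, there is an indeterminacy datum with bare region `A`, (Ind3)-region `B`, `q`-image `Q`,
and (Ind1) = (Ind2) := the FULL STABILISER of `B` in the symmetric group of the carrier `𝕃` (the largest
indeterminacy groups acting on `𝕃` for which every possible image is `B` itself): all possible images equal `B`,
`−|log(Θ)| = ln ν̄(hull B)`, `−|log(q)| = ln ν̄(Q)`, XVIII's modelling hypothesis «(Ind1), (Ind2) preserve `ln ν̄` of the
(Ind3)-region» HOLDS, and Reading 1 (`RepresentedVol`) reads `ln ν̄(B) = ln ν̄(Q)`. MODEL witness (label: the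
indeterminacies act trivially ON THE REGION, not on `𝕃`). [cite: DupuyHilado2025, §4.11 p. 16, §1 pp. 3–4] -/
theorem exists_stabilizer_model {A B Q : Set V.L} (hAB : A ⊆ B) (hB : V.Adm B) (hhB : V.Adm (V.hull B))
    (hQ : V.Adm Q) :
    ∃ I : IndData V, I.G₁ = ↥(MulAction.stabilizer (Equiv.Perm V.L) B) ∧
      I.G₂ = ↥(MulAction.stabilizer (Equiv.Perm V.L) B) ∧ I.bare = A ∧ I.bare3 = B ∧ I.Q = Q ∧
      (∀ p : I.G₂ × I.G₁, I.toSetting.U p = B) ∧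
      (∀ (g₂ : I.G₂) (g₁ : I.G₁), V.logvol (g₂ • g₁ • I.bare3) = V.logvol I.bare3) ∧
      I.toSetting.negLogTheta = V.logvol (V.hull B) ∧ I.toSetting.negAbsLogq = V.logvol Q ∧
      (I.toSetting.RepresentedVol ↔ V.logvol B = V.logvol Q) := by
  classical
  have hG : ∀ g : ↥(MulAction.stabilizer (Equiv.Perm V.L) B), (g • B : Set V.L) = B := fun g =>
    MulAction.mem_stabilizer_iff.mp g.2
  have hU : (⋃ p : ↥(MulAction.stabilizer (Equiv.Perm V.L) B) × ↥(MulAction.stabilizer (Equiv.Perm V.L) B),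
      p.1 • p.2 • B) = B := by
    apply Set.Subset.antisymm
    · intro x hx
      obtain ⟨p, hp⟩ := Set.mem_iUnion.mp hx
      rwa [hG p.2, hG p.1] at hp
    · intro x hx
      exact Set.mem_iUnion.mpr ⟨(1, 1), by rwa [hG, hG]⟩
  let I : IndData V :=
    { G₁ := ↥(MulAction.stabilizer (Equiv.Perm V.L) B)
      G₂ := ↥(MulAction.stabilizer (Equiv.Perm V.L) B)
      bare := A
      bare3 := B
      bare_subset_bare3 := hAB
      image_adm := fun g₂ g₁ => by rw [hG g₁, hG g₂]; exact hB
      hull_adm := by rw [hU]; exact hhB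
      Q := Q
      Q_adm := hQ }
  have hpres : ∀ (g₂ : I.G₂) (g₁ : I.G₁), V.logvol (g₂ • g₁ • I.bare3) = V.logvol I.bare3 := fun g₂ g₁ => by
    show V.logvol (g₂ • g₁ • B) = V.logvol B
    rw [hG g₁, hG g₂]
  refine ⟨I, rfl, rfl, rfl, rfl, rfl, fun p => ?_, hpres, ?_, rfl, ?_⟩
  · show p.1 • p.2 • B = B
    rw [hG p.2, hG p.1]
  · show V.logvol (V.hull (⋃ p : I.G₂ × I.G₁, p.1 • p.2 • B)) = V.logvol (V.hull B)
    rw [hU]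
  · exact I.representedVol_iff_of_preserving hpres

open MeasureTheory in
/-- **The set-stabiliser model over LEBESGUE MEASURE ON `ℝ`** (abc-iut-c312-4's `measureContainer`: admissible =
measurable of finite nonzero measure, `ln ν̄ = log μ`, hull := identity): bare region `[0,1]`, (Ind3)-region `[0,2]`,
`q`-image `[0,1]`. Then `−|log(Θ)| = log 2`, `−|log(q)| = 0`, the setting's inequality `Cor312` (`−|log(q)| ≤ −|log(Θ)|`)
HOLDS and Reading 1 `RepresentedVol` («some possible image has log-volume `−|log(q)|`») FAILS — on a real measure the
two readings of XVII separate. MODEL witness; nothing about `p`-adic packets. [cite: DupuyHilado2025, §1 pp. 3–4] -/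
theorem exists_lebesgue_model :
    ∃ I : IndData (measureContainer (volume : Measure ℝ) (ClosureOperator.id (Set ℝ))),
      I.bare = (Icc (0 : ℝ) 1 : Set ℝ) ∧ I.bare3 = (Icc (0 : ℝ) 2 : Set ℝ) ∧ I.Q = (Icc (0 : ℝ) 1 : Set ℝ) ∧
      I.toSetting.negLogTheta = Real.log 2 ∧ I.toSetting.negAbsLogq = 0 ∧
      I.toSetting.Cor312 ∧ ¬ I.toSetting.RepresentedVol := by
  have hadm : ∀ {a b : ℝ}, a < b →
      (measureContainer (volume : Measure ℝ) (ClosureOperator.id (Set ℝ))).Adm (Icc a b : Set ℝ) := by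
    intro a b hab
    refine ⟨measurableSet_Icc, ?_, ?_⟩
    · show volume (Icc a b) ≠ 0
      rw [Real.volume_Icc]
      exact (ENNReal.ofReal_pos.mpr (sub_pos.mpr hab)).ne'
    · show volume (Icc a b) ≠ ⊤
      rw [Real.volume_Icc]
      exact ENNReal.ofReal_ne_top
  have hvol : ∀ {a b : ℝ}, a ≤ b →
      (measureContainer (volume : Measure ℝ) (ClosureOperator.id (Set ℝ))).logvol (Icc a b : Set ℝ) =
        Real.log (b - a) := by
    intro a b hab
    show Real.log ((volume (Icc a b)).toReal) = Real.log (b - a)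
    rw [Real.volume_Icc, ENNReal.toReal_ofReal (sub_nonneg.mpr hab)]
  have hsub : (Icc (0 : ℝ) 1 : Set ℝ) ⊆ Icc (0 : ℝ) 2 := Icc_subset_Icc le_rfl (by norm_num)
  obtain ⟨I, -, -, hbare, hbare3, hQ, -, -, hΘ, hq, hrep⟩ :=
    exists_stabilizer_model (V := measureContainer (volume : Measure ℝ) (ClosureOperator.id (Set ℝ)))
      (A := (Icc (0 : ℝ) 1 : Set ℝ)) (B := (Icc (0 : ℝ) 2 : Set ℝ)) (Q := (Icc (0 : ℝ) 1 : Set ℝ)) hsub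
      (hadm (by norm_num)) (hadm (by norm_num)) (hadm (by norm_num))
  have hΘ' : I.toSetting.negLogTheta = Real.log 2 := by
    rw [hΘ]
    show (measureContainer (volume : Measure ℝ) (ClosureOperator.id (Set ℝ))).logvol (Icc (0 : ℝ) 2 : Set ℝ) =
      Real.log 2
    rw [hvol (by norm_num)]
    norm_num
  have hq' : I.toSetting.negAbsLogq = 0 := by
    rw [hq, hvol (by norm_num)]
    norm_num
  refine ⟨I, hbare, hbare3, hQ, hΘ', hq', ?_, ?_⟩
  · show I.toSetting.negAbsLogq ≤ I.toSetting.negLogTheta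
    rw [hΘ', hq']
    exact Real.log_nonneg (by norm_num)
  · rw [hrep, hvol (by norm_num), hvol (by norm_num)]
    norm_num

end IndData

/-! ## 3. The numbers of [IUTchIII] Rmk 3.12.1 (ii) (`Cor312Remarks`) -/

namespace Cor312Rmk.GeneralizedVolumes

/-- The record of Rmk 3.12.1 (ii) numbers is inhabited with `λ = 1` and the claim-form `Cor312` TRUE
(`−|log(Θ)| := 0`, `|log(q)| := 1`). PARAMETER-RECORD witness. [cite: Mochizuki2012, III Rmk 3.12.1 (ii) p.186] -/
theorem exists_cor312 : ∃ V : GeneralizedVolumes, V.lam = 1 ∧ V.Cor312 :=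
  ⟨⟨1, one_pos, 0, 1, one_pos⟩, rfl, by unfold GeneralizedVolumes.Cor312; push_cast; norm_num⟩

/-- … and with `λ = 1` and the claim-form `Cor312` FALSE (`−|log(Θ)| := −2`, `|log(q)| := 1`): the typed fields do not
force the claim-form (TEETH: `Cor312` is a genuine hypothesis of `neg_lam_le`). [cite: Mochizuki2012, III Rmk 3.12.1 (ii) p.186] -/
theorem exists_not_cor312 : ∃ V : GeneralizedVolumes, V.lam = 1 ∧ ¬ V.Cor312 :=
  ⟨⟨1, one_pos, -2, 1, one_pos⟩, rfl, by unfold GeneralizedVolumes.Cor312; push_cast; norm_num⟩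

/-- The same at a generalized exponent `λ = 1/2 < 1` with `Cor312` TRUE (`−|log(Θ)| := 0`).
[cite: Mochizuki2012, III Rmk 3.12.1 (ii) p.186] -/
theorem exists_cor312_half : ∃ V : GeneralizedVolumes, V.lam = 1 / 2 ∧ V.Cor312 :=
  ⟨⟨1 / 2, by norm_num, 0, 1, one_pos⟩, rfl, by unfold GeneralizedVolumes.Cor312; push_cast; norm_num⟩

/-- … and at `λ = 1/2` with `Cor312` FALSE (`−|log(Θ)| := −1`, `|log(q)| := 1`: `−1/2 ≰ −1`).
[cite: Mochizuki2012, III Rmk 3.12.1 (ii) p.186] -/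
theorem exists_not_cor312_half : ∃ V : GeneralizedVolumes, V.lam = 1 / 2 ∧ ¬ V.Cor312 :=
  ⟨⟨1 / 2, by norm_num, -1, 1, one_pos⟩, rfl, by unfold GeneralizedVolumes.Cor312; push_cast; norm_num⟩

end Cor312Rmk.GeneralizedVolumes

/-! ## 4. LANA §6.3 (6-5): cyclotomic rigidity as an interface (`LanaCyclotomes`, X) -/

namespace LocalCyclotomicRigidity

open Literature.AnabelianGeometry.EtaleTheta

variable {G M : Type} [Group G] [CommGroup M] [MulDistribMulAction G M]

/-- TAUTOLOGICAL witness: at `Λ(G) := Λ(M)` itself the identity is a `G`-equivariant rigidity isomorphism, for EVERY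
`G ↷ M`. (The interface constrains only once `Λ(G)` is the cyclotome reconstructed from `G` alone — [AbsTopIII]/[EtTh]
content, as the structure's docstring says; this witness certifies satisfiability of the two typed fields.)
[cite: LANA2026Report, §6.3 (6-5) p. 37] -/
theorem nonempty_self : Nonempty (LocalCyclotomicRigidity G M (cyclotome M)) :=
  ⟨{ ι := MulEquiv.refl _, ι_smul := fun _ _ => rfl }⟩

/-- **THE INTERFACE DOES NOT PIN `ι`.** If `Λ(M)` has an element `ζ ≠ ζ⁻¹`, there are TWO DISTINCT rigidity data onto
the same `Λ(G) := Λ(M)`: the identity and INVERSION (`ζ ↦ ζ⁻¹`, the power map of exponent `−1 ∈ Ẑ^×`), both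
`G`-equivariant — the typed form of §6.3's «without this rigidity … what is determined is not the Θ-value itself, but
only its `Ẑ^×`-power orbit». [cite: LANA2026Report, §6.3 pp. 36–37] -/
theorem exists_ne_of_ne_inv (h : ∃ ζ : cyclotome M, ζ ≠ ζ⁻¹) :
    ∃ R R' : LocalCyclotomicRigidity G M (cyclotome M), R ≠ R' := by
  obtain ⟨ζ, hζ⟩ := h
  refine ⟨{ ι := MulEquiv.refl _, ι_smul := fun _ _ => rfl },
    { ι := MulEquiv.inv (cyclotome M),
      ι_smul := fun g ξ => by
        show (g • ξ)⁻¹ = g • ξ⁻¹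
        exact (smul_inv' g ξ).symm }, fun hRR' => hζ ?_⟩
  have h1 := congrArg (fun R : LocalCyclotomicRigidity G M (cyclotome M) => R.ι ζ) hRR'
  simpa using h1

/-- **… and this happens for `M := ℂˣ`, unconditionally**: the compatible system of roots of unity
`n ↦ exp(2πi/n)` is an element `ζ ∈ Λ(ℂˣ) = lim_n ℂˣ[n]` with `ζ ≠ ζ⁻¹` (at level `4`: `i ≠ −i`), so for every group
`G` acting on `ℂˣ` by automorphisms (here `G := Aut(ℂˣ)`) the rigidity interface onto `Λ(G) := Λ(ℂˣ)` has two distinct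
inhabitants. Classical content (Mathlib's `Complex.exp`). [cite: LANA2026Report, §0.4 (f) p. 8, §6.3 pp. 36–37] -/
theorem exists_ne_complexUnits :
    ∃ R R' : LocalCyclotomicRigidity (MulAut ℂˣ) ℂˣ (cyclotome ℂˣ), R ≠ R' := by
  -- the compatible system of roots of unity `ζ_n := exp (2πi / n)`
  let z : ℕ+ → ℂˣ := fun n =>
    Units.mk0 (Complex.exp (2 * Real.pi * Complex.I / (n : ℂ))) (Complex.exp_ne_zero _)
  have hz : ∀ n : ℕ+, ((z n : ℂˣ) : ℂ) = Complex.exp (2 * Real.pi * Complex.I / (n : ℂ)) := fun n => rfl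
  have hn : ∀ n : ℕ+, ((n : ℕ) : ℂ) ≠ 0 := fun n => Nat.cast_ne_zero.mpr n.ne_zero
  have hmem : z ∈ cyclotome ℂˣ := by
    refine ⟨fun n => ?_, fun n m => ?_⟩
    · apply Units.ext
      rw [Units.val_pow_eq_pow_val, hz, Units.val_one, ← Complex.exp_nat_mul,
        mul_div_cancel₀ _ (hn n), Complex.exp_two_pi_mul_I]
    · apply Units.ext
      rw [Units.val_pow_eq_pow_val, hz, hz, ← Complex.exp_nat_mul]
      congr 1
      rw [PNat.mul_coe, Nat.cast_mul]
      field_simp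
  refine exists_ne_of_ne_inv ⟨⟨z, hmem⟩, fun h => ?_⟩
  -- at level 4: `exp(2πi/4) = exp(2πi/4)⁻¹` would give `exp(πi) = 1`
  have h4 : z 4 = (z 4)⁻¹ := by
    have := congrArg (fun ζ : cyclotome ℂˣ => (ζ : ℕ+ → ℂˣ) 4) h
    simpa using this
  have h4' : ((z 4 : ℂˣ) : ℂ) * ((z 4 : ℂˣ) : ℂ) = 1 := by
    rw [← Units.val_mul, mul_eq_one_iff_eq_inv.mpr h4, Units.val_one]
  rw [hz, ← Complex.exp_add, ← Complex.exp_zero] at h4'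
  have hπ : Complex.exp (Real.pi * Complex.I) = 1 := by
    have e : 2 * (Real.pi : ℂ) * Complex.I / ((4 : ℕ+) : ℕ) + 2 * Real.pi * Complex.I / ((4 : ℕ+) : ℕ) =
        Real.pi * Complex.I := by
      have h4c : (((4 : ℕ+) : ℕ) : ℂ) = 4 := by norm_num
      rw [h4c]
      ring
    rw [← e, h4', Complex.exp_zero]
  rw [Complex.exp_pi_mul_I] at hπ
  norm_num at hπ

end LocalCyclotomicRigidity

/-! ## 5. Per-packet volume data of a strip algorithm (`Cor312GapGlobalCountermodel`, XXVI) -/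

namespace InputStrip

open Thm311 Cor312 Cor312Vol Literature.IUT.LogThetaLattice

variable {T : ThetaIndex} {S : Situation T} {P : Cor312.Setting S}

/-- For EVERY strip algorithm over EVERY verbatim setting a per-packet volume datum exists: read every input at the
`q`-pilot's local volumes `qLocal` (the only constraint typed is the one at the `q`-strip). DEGENERATE witness
(constant in the input). [claim: Mochizuki2012, status: disputed] for the interface; the witness is folklore. -/
theorem LocalVolumes.nonempty (A : StripAlgorithm P) : Nonempty (LocalVolumes A) :=
  ⟨{ holVolLocal := fun _ i vQ => P.qLocal (Setting.labelSucc i) vQ, holVolLocal_qIn := fun _ _ => rfl }⟩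

/-- Hence XXVI's `lg_gapGlobal_not_soundPerPacket` speaks about an inhabited type: there ARE a strip algorithm over
`LocalGlobal.lgSetting` and a per-packet volume datum for it at which the GLOBAL gap holds while PER-PACKET soundness at
the `q`-strip fails (the two quantifier levels of GapA separate on an instance, not only hypothetically). [folklore] -/
theorem exists_gapGlobal_not_soundPerPacket :
    ∃ (A : StripAlgorithm LocalGlobal.lgSetting) (V : LocalVolumes A), A.GapGlobal ∧ ¬ A.SoundPerPacket V A.qIn :=
  ⟨StripAlgorithm.canonical _, Classical.choice (LocalVolumes.nonempty _),
    lg_gapGlobal_not_soundPerPacket _ _⟩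

end InputStrip

end IUTFork
end Summit.ABC

end
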